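import Summits.QuantumFields.GaugeBoot.HaarShiftUniqueness
import Summits.QuantumFields.GaugeBoot.TiltedBoxLimitHaarShift
import HarnessLib

/-!
# At strong coupling the tilted and the cubic limit states coincide, and Class T = Class B = {the DLR state} (gauge-boot, Class B / Class T)

HONEST FRAMING (cell `pub-gaugeboot`, page 1 of every file): the venture produces certified bounds
on lattice expectations at stated coupling, gauge group, dimension and torus size; NOT a mass gap,
NOT a continuum limit, NOT a string tension; NOT Yang–Mills-summit-bearing (barriers
`FixedCouplingUltralocality`, `PerturbativeInvisibility`). STRONG-COUPLING structural statements
(`6(d-1) N |β| < 1`); nothing at the couplings of the cell's certificates.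

## Content

Sequel of `HaarShiftDLR.lean` (Haar-shift states = DLR states) and `HaarShiftUniqueness.lean`
(at `6(d-1) N |β| < 1` there is exactly one Haar-shift probability state):

* `setOf_isHaarShiftState_eq_ymGibbsMeasures` — for every real `β`:
  `{μ probability | IsHaarShiftState ρ β μ} = 𝒢(β)` as sets;
* ★ `IsHaarShiftState.isInfiniteVolumeLimit_of_small` — at strong coupling a Haar-shift state is
  THE infinite-volume limit: the FULL sequence of torus Wilson states converges to it
  (`hasUniqueInfiniteVolumeLimit_of_subsingleton`);
* ★★ `TiltedRP.tiltedBoxLimitPoints_eq_infiniteVolumeLimitPoints_of_small` — at strong coupling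
  the limit points of the 45°-TILTED boxes and of the CUBIC tori are the same set (a singleton):
  this discharges, in Dobrushin's regime, the relation left open in `TiltedBoxLimitClass.lean`
  ("equal under Gibbs uniqueness, not shown here"); `…_suN`;
* ★★ `TiltedRP.TiltedClassState.exists_classBState_eq_of_small` /
  `IsHaarShiftState.exists_classBState_eq_of_small` — at strong coupling (`0 ≤ β`) every Class-T
  state, indeed every Haar-shift probability state, is the measure of a Class-B state: Class T and
  Class B quantify over the same single state there (`ClassBState.toTiltedClassState` is the other
  direction, every `β`);
* ★★★ `TiltedRP.isEmpty_tiltedClassState_of_neg_of_small_uN` — the `U(N)` form of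
  "Class T is empty at small negative coupling in every dimension" (`HaarShiftUniqueness.lean` has
  `SU(N)`).

References: R. L. Dobrushin (1968); H.-O. Georgii (2011) Thm. 1.33, Ch. 8; S. Friedli, Y. Velenik
(2017) Lemma 6.30; V. Kazakov, Z. Zheng, arXiv:2203.11360 §3.1. Folklore; the Class-B/T statements
are the cell's own bookkeeping.
-/

noncomputable section

open MeasureTheory
open scoped ComplexOrder ComplexConjugate
open Literature.Probability.LatticeModels (Site)
open Literature.MathematicalPhysics.QuantumLattice
open Literature.MathematicalPhysics.QuantumFieldTheory (haarProbability)

namespace Summit.QuantumFields.GaugeBoot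

variable {d N : ℕ} {G : Type} [Group G] [TopologicalSpace G] [IsTopologicalGroup G]
  [CompactSpace G] [MeasurableSpace G] [BorelSpace G] [T2Space G] [SecondCountableTopology G]
variable (ρ : G →* Matrix (Fin N) (Fin N) ℂ)

/-! ## Haar-shift probability states as a set -/

/-- **The Haar-shift probability states are exactly the DLR states, as a set identity** (every
real `β`; `HaarShiftDLR.isHaarShiftState_iff_mem_ymGibbsMeasures`). [folklore] -/
theorem setOf_isHaarShiftState_eq_ymGibbsMeasures (hρ : Continuous ρ) (β : ℝ) :
    {μ : Measure (LGConfig d G) | IsProbabilityMeasure μ ∧ IsHaarShiftState ρ β μ} =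
      ymGibbsMeasures ρ β := by
  ext μ
  constructor
  · rintro ⟨hprob, hμ⟩
    haveI := hprob
    exact mem_ymGibbsMeasures_of_isHaarShiftState ρ hρ hμ
  · intro hμ
    have hG : Literature.Probability.LatticeModels.IsGibbsMeasure (ymSpecification ρ β) μ := hμ
    exact ⟨hG.isProbabilityMeasure, isHaarShiftState_of_mem_ymGibbsMeasures ρ hρ hμ⟩

/-! ## At strong coupling a Haar-shift state is THE infinite-volume limit -/

section Limit

/-- ★ **At strong coupling the full sequence of torus Wilson states converges to any given
Haar-shift probability state** (`6(d-1) N |β| < 1`): uniqueness of the DLR state gives a unique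
infinite-volume limit (`hasUniqueInfiniteVolumeLimit_of_subsingleton`), and the Haar-shift state is
one of its limit points (`IsHaarShiftState.mem_infiniteVolumeLimitPoints_of_small`). [folklore] -/
theorem IsHaarShiftState.isInfiniteVolumeLimit_of_small (hρ : Continuous ρ) {β : ℝ}
    (hβ : 6 * ((d - 1 : ℕ) : ℝ) * N * |β| < 1) {μ : Measure (LGConfig d G)}
    [IsProbabilityMeasure μ] (hμ : IsHaarShiftState ρ β μ) :
    IsInfiniteVolumeLimit (d := d) ρ β μ := by
  obtain ⟨ν, hν, hpts⟩ := hasUniqueInfiniteVolumeLimit_of_subsingleton (d := d) ρ hρ β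
    (subsingleton_ymGibbsMeasures_allGroups ρ hρ hβ)
  have hmem := hμ.mem_infiniteVolumeLimitPoints_of_small ρ hρ hβ
  rw [hpts, Set.mem_singleton_iff] at hmem
  rw [hmem]
  exact hν

/-- At strong coupling the set of infinite-volume limit points is the singleton of any Haar-shift
probability state. [folklore] -/
theorem IsHaarShiftState.infiniteVolumeLimitPoints_eq_singleton_of_small (hρ : Continuous ρ)
    {β : ℝ} (hβ : 6 * ((d - 1 : ℕ) : ℝ) * N * |β| < 1) {μ : Measure (LGConfig d G)}
    [IsProbabilityMeasure μ] (hμ : IsHaarShiftState ρ β μ) :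
    infiniteVolumeLimitPoints (d := d) ρ β = {μ} := by
  ext ν
  rw [Set.mem_singleton_iff]
  constructor
  · intro hν
    exact (hμ.eq_of_mem_infiniteVolumeLimitPoints_of_small ρ hρ hβ hν).symm
  · rintro rfl
    exact hμ.mem_infiniteVolumeLimitPoints_of_small ρ hρ hβ

end Limit

/-! ## Tilted and cubic limit points coincide at strong coupling -/

namespace TiltedRP

variable {i j : Fin d}

/-- **Every tilted limit point is a cubic torus limit point at strong coupling** (`6(d-1) N |β| < 1`,
either sign of `β`): tilted limit points are Haar-shift probability states
(`isHaarShiftState_of_mem_tiltedBoxLimitPoints`), and such a state is a torus limit point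
(`IsHaarShiftState.mem_infiniteVolumeLimitPoints_of_small`). [folklore] -/
theorem tiltedBoxLimitPoints_subset_infiniteVolumeLimitPoints_of_small (hρ : Continuous ρ) {β : ℝ}
    (hβ : 6 * ((d - 1 : ℕ) : ℝ) * N * |β| < 1) :
    tiltedBoxLimitPoints d i j ρ β ⊆ infiniteVolumeLimitPoints (d := d) ρ β := by
  intro μ hμ
  haveI := isProbabilityMeasure_of_mem_tiltedBoxLimitPoints hμ
  exact (isHaarShiftState_of_mem_tiltedBoxLimitPoints ρ hρ hμ).mem_infiniteVolumeLimitPoints_of_small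
    ρ hρ hβ

/-- ★★ **At strong coupling the limit points of the 45°-tilted boxes and of the cubic tori are the
SAME set** (`6(d-1) N |β| < 1`; both are the singleton of the unique DLR state). In
`TiltedBoxLimitClass.lean` this relation was left open ("equal under Gibbs uniqueness, not shown
here"); this is the Dobrushin-regime case. [folklore] -/
theorem tiltedBoxLimitPoints_eq_infiniteVolumeLimitPoints_of_small (hρ : Continuous ρ) {β : ℝ}
    (hβ : 6 * ((d - 1 : ℕ) : ℝ) * N * |β| < 1) :
    tiltedBoxLimitPoints d i j ρ β = infiniteVolumeLimitPoints (d := d) ρ β := by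
  refine Set.Subset.antisymm (tiltedBoxLimitPoints_subset_infiniteVolumeLimitPoints_of_small ρ hρ hβ)
    fun ν hν => ?_
  obtain ⟨μ, hμ⟩ := tiltedBoxLimitPoints_nonempty (d := d) (i := i) (j := j) (ρ := ρ) hρ β
  haveI := isProbabilityMeasure_of_mem_tiltedBoxLimitPoints hμ
  have h := (isHaarShiftState_of_mem_tiltedBoxLimitPoints ρ hρ hμ).eq_of_mem_infiniteVolumeLimitPoints_of_small
    ρ hρ hβ hν
  rw [← h]
  exact hμ

/-- ★ At strong coupling the tilted limit points form the singleton of the unique DLR state: any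
Haar-shift probability state. [folklore] -/
theorem tiltedBoxLimitPoints_eq_singleton_of_small (hρ : Continuous ρ) {β : ℝ}
    (hβ : 6 * ((d - 1 : ℕ) : ℝ) * N * |β| < 1) {μ : Measure (LGConfig d G)}
    [IsProbabilityMeasure μ] (hμ : IsHaarShiftState ρ β μ) :
    tiltedBoxLimitPoints d i j ρ β = {μ} := by
  rw [tiltedBoxLimitPoints_eq_infiniteVolumeLimitPoints_of_small ρ hρ hβ,
    hμ.infiniteVolumeLimitPoints_eq_singleton_of_small ρ hρ hβ]

/-! ## Class T = Class B at strong coupling -/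

/-- ★★ **At strong coupling every Class-T state is the measure of a Class-B state** (`0 ≤ β`,
`6(d-1) N β < 1`): its measure is a torus limit point (`TiltedClassState.μ_mem_infiniteVolumeLimitPoints_of_small`)
and torus limit points are Class B there (`thermodynamicLimitIsClassB_allGroups`). With
`ClassBState.toTiltedClassState` (every `β`): Class T and Class B quantify over the same single state
at strong coupling. -/
theorem TiltedClassState.exists_classBState_eq_of_small [NeZero d] (hρ : Continuous ρ) {β : ℝ}
    (hβ0 : 0 ≤ β) (hβ : 6 * ((d - 1 : ℕ) : ℝ) * N * β < 1) (ω : TiltedClassState d i j ρ β) :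
    ∃ ω' : ClassBState d ρ β, ω'.μ = ω.μ :=
  thermodynamicLimitIsClassB_allGroups ρ hρ hβ0 hβ ω.μ
    (ω.μ_mem_infiniteVolumeLimitPoints_of_small ρ hρ (by rwa [abs_of_nonneg hβ0]))

end TiltedRP

/-- ★★ **At strong coupling every Haar-shift probability state is the measure of a Class-B state**
(`0 ≤ β`, `6(d-1) N β < 1`): the loop equations alone already force all three reflection
positivities and all lattice symmetries there. -/
theorem IsHaarShiftState.exists_classBState_eq_of_small [NeZero d] (hρ : Continuous ρ) {β : ℝ}
    (hβ0 : 0 ≤ β) (hβ : 6 * ((d - 1 : ℕ) : ℝ) * N * β < 1) {μ : Measure (LGConfig d G)}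
    [IsProbabilityMeasure μ] (hμ : IsHaarShiftState ρ β μ) : ∃ ω : ClassBState d ρ β, ω.μ = μ :=
  thermodynamicLimitIsClassB_allGroups ρ hρ hβ0 hβ μ
    (hμ.mem_infiniteVolumeLimitPoints_of_small ρ hρ (by rwa [abs_of_nonneg hβ0]))

/-- ★★ At strong coupling (`0 ≤ β`, `6(d-1) N β < 1`) a Haar-shift probability state is reflection
positive for EVERY diagonal mirror (it is Class B). Contrast: at `-1/(6(d-1)N) < β < 0` it is
reflection positive for NO diagonal mirror (`false_of_haarShift_diagRP_of_neg_of_small`, `ρ`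
non-trivial). -/
theorem IsHaarShiftState.diagRP_of_small [NeZero d] (hρ : Continuous ρ) {β : ℝ} (hβ0 : 0 ≤ β)
    (hβ : 6 * ((d - 1 : ℕ) : ℝ) * N * β < 1) {μ : Measure (LGConfig d G)} [IsProbabilityMeasure μ]
    (hμ : IsHaarShiftState ρ β μ) {i j : Fin d} (hij : i ≠ j) :
    IsReflectionPositiveFor (configDiagSwapZd (G := G) i j) (diagHalfEdges i j) μ := by
  obtain ⟨ω, hω⟩ := hμ.exists_classBState_eq_of_small ρ hρ hβ0 hβ
  rw [← hω]
  exact ω.diagRP i j hij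

/-! ## `SU(N)` and `U(N)` -/

section Unitary

open Literature.MathematicalPhysics.QuantumFieldTheory in
/-- ★★ **`SU(N)` at strong coupling: tilted and cubic limit points coincide** (`6(d-1) N |β| < 1`). -/
theorem TiltedRP.tiltedBoxLimitPoints_eq_infiniteVolumeLimitPoints_of_small_suN {d N : ℕ}
    {i j : Fin d} {β : ℝ} (hβ : 6 * ((d - 1 : ℕ) : ℝ) * N * |β| < 1) :
    tiltedBoxLimitPoints d i j (fundamentalRep (Fin N)) β =
      infiniteVolumeLimitPoints (d := d) (fundamentalRep (Fin N)) β := by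
  haveI : SecondCountableTopology (Matrix (Fin N) (Fin N) ℂ) :=
    inferInstanceAs (SecondCountableTopology (Fin N → Fin N → ℂ))
  haveI : SecondCountableTopology (Matrix.specialUnitaryGroup (Fin N) ℂ) :=
    Topology.IsEmbedding.subtypeVal.secondCountableTopology
  exact TiltedRP.tiltedBoxLimitPoints_eq_infiniteVolumeLimitPoints_of_small (fundamentalRep (Fin N))
    (continuous_fundamentalRep (Fin N)) hβ

open Literature.MathematicalPhysics.QuantumFieldTheory in
/-- ★★★ **`U(N)`, `N ≥ 1`, any `d`, `i ≠ j`, `-1/(6(d-1)N) < β < 0`: Class T is empty** (the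
`SU(N)` form is `TiltedRP.isEmpty_tiltedClassState_of_neg_of_small_suN`). -/
theorem TiltedRP.isEmpty_tiltedClassState_of_neg_of_small_uN {d N : ℕ} {i j : Fin d} (hij : i ≠ j)
    (hN : 1 ≤ N) {β : ℝ} (hβ : β < 0) (hsmall : 6 * ((d - 1 : ℕ) : ℝ) * N * |β| < 1) :
    IsEmpty (TiltedRP.TiltedClassState d i j (unitaryFundamentalRep (Fin N) ℂ) β) := by
  haveI : NeZero N := ⟨by omega⟩
  haveI : SecondCountableTopology (Matrix.unitaryGroup (Fin N) ℂ) :=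
    IsUnitaryModel.secondCountableTopology _ (isUnitaryModel_unitaryFundamentalRep N)
  obtain ⟨z, hz, -⟩ := IsUnitaryModel.exists_central (unitaryFundamentalRep (Fin N) ℂ)
    (isUnitaryModel_unitaryFundamentalRep N)
  refine TiltedRP.isEmpty_tiltedClassState_of_neg_of_small (unitaryFundamentalRep (Fin N) ℂ) hij
    (continuous_unitaryFundamentalRep (Fin N) ℂ) ⟨z, ?_⟩ hβ hsmall
  rw [hz]
  simp only [Matrix.trace_neg, Matrix.trace_one, Fintype.card_fin, Complex.neg_re,
    Complex.natCast_re]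
  have hN' : (0 : ℝ) < N := by exact_mod_cast hN
  linarith

end Unitary

end Summit.QuantumFields.GaugeBoot
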